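import Literature.MathematicalPhysics.QuantumFieldTheory.Balaban1983to89.B9Thm31SiteConjugatedFormY
import Literature.MathematicalPhysics.QuantumFieldTheory.Balaban1983to89.B9Thm311FlippedBondLetters

/-!
# `Balaban1983to89.B9Thm31SiteGpDecayReg335Y` — T. Bałaban, *Propagators for lattice gauge theories in a background field*, Commun. Math. Phys.
# **99** (1985) 389–434 [Balaban1985BackgroundPropagators] Thm 3.1 (3.46) p. 398 with (3.24) p. 394, (3.35) p. 396, by S. Agmon's positive-weight method
# [Agmon1982]: ★★★ **THE `L²`-LOCAL DECAY OF def-Y's `G′(U) = Δ′_a(U)⁻¹` ON THE (3.35) CLASS — `‖1_A G′(U) 1_B‖ ≤ 16·L^{j_A}·L^{j_B}·e^{−(weight gap)}`,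
# the SHAPE of print's (3.46a) `‖hG′(U)λ‖ ≤ B₀(Lʲη)(Lʲ′η)e^{−δ₀d(y,y′)}‖h‖‖λ‖`, member-∕volume-∕k-∕N-∕U-uniformly** (file 6 of the site-coercivity set of width
# seat `pub-ymgap-dag-n06-w1`; the weight exponent is a parameter, instantiated as `e^{δρ}` in file 7)

statement-level skeleton of published theorems with citation tags; proofs where landed; nothing here is a claim about the Yang–Mills mass gap

THE PRINT (verbatim, p. 398).  *«Finally, we have the inequalities in L₂-norms ‖hG′(U)λ‖, ‖hζ∇_UG′(U)λ‖(Lʲη), … ≤ B₀(Lʲη)(Lʲ′η)e^{−δ₀d(y,y′)}‖h‖‖λ‖ for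
supp h ⊂ Δ̃(y), y ∈ Λ_j, supp λ ⊂ Δ̃(y′); (3.46) … It is easy to see that the global inequalities (3.47) are consequences of the local ones (3.42) and Lemma 2.1.
We will prove the above theorem by constructing a random walk representation …»*  Thm 3.1's hypotheses: `U` in the class (3.35) with `Mα₀ ≤ a₀`, `M ≥ M₁`.

WHY THIS FILE ∕ THE ARGUMENT.  Files 3c (p589008), 5a∕5b of this seat give, on def-Y's class `(bg9K (M_N ℂ) G i).Reg335 c α₀` with `c·M·α₀·(d+1) ≤ 1∕16`:
the LEVEL-WEIGHTED coercivity `(1∕8)Σ_z m_z HS(Φ z) ≤ ⟨Φ, Δ′_a(U)Φ⟩₁` (`m_z = (L^{lev z})⁻²`) and, for a site weight `ω > 0` with bond ratios `q ≤ θ_b·m` and block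
oscillation `q ≤ θ_s`, the conjugated lower bound `⟨Φ, Δ′_aΦ⟩₁ − ((d+1)θ_b + θ_s∕2)Σ_z m_z HS(Φ z) ≤ ⟨ωΦ, Δ′_a(U)(ω⁻¹Φ)⟩₁`.  Agmon's argument (§2): put
`Φ := G′(U)Ψ` with `Ψ` supported in `B` and `ω ≡ 1` on `B`; at `Φ′ = ωΦ` the conjugated form is `⟨ω²Φ, Δ′_aΦ⟩₁ = ⟨ω²Φ, Ψ⟩₁ = ⟨1_BΦ, Ψ⟩₁ ≤ ‖1_BΦ‖·‖Ψ‖`, while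
it is `≥ c₀Σ_z m_z ω_z² HS(Φ z)` (`c₀ = 1∕8 − (d+1)θ_b − θ_s∕2 ≥ 1∕16`); reading the latter once on `B` (`ω = 1`, `m ≥ m_B`) bounds `‖1_BΦ‖ ≤ ‖Ψ‖∕(c₀m_B)`, and
then on `A` (`ω ≥ W`, `m ≥ m_A`): `‖1_AΦ‖² ≤ ‖Ψ‖²∕(c₀² m_A m_B W²) = 256·(L^{j_A})²(L^{j_B})²·W⁻²·‖Ψ‖²` — print's `B₀(Lʲη)(Lʲ′η)e^{−δ₀d}` with `B₀ = 16`.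

WHAT IS PROVED (sorry-free; 0 `def`; nothing of [B9] asserted beyond what is proved).
* §1 ★★ `trIP_wsmul_deltaPrimeAY_winv_ge_levelMass` — ON THE CLASS: `(1∕8 − (d+1)θ_b − θ_s∕2)·Σ_z m_z HS(Φ z) ≤ ⟨ωΦ, Δ′_a(U)(ω⁻¹Φ)⟩₁`.
* §2 bookkeeping (`trIP_wsq_eq_of_support`, `abs_trIP_le_of_support`, `sum_filter_hs_le_levelMass`, `agmon_arith_pairing`, `agmon_arith`,
  `agmon_unpack`, ★ `conj_wsmul_GpY_eq_pairing`), the two Agmon readings ★★ `levelMass_wsmul_GpY_le_pairing` (`c₀Σ_z m_zHS(ω_z(G′Ψ)z) ≤ ⟨G′Ψ, Ψ⟩₁`), ★★ `pairing_GpY_le_of_support`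
  (`c₀(L^{j_B})⁻²⟨G′Ψ, Ψ⟩₁ ≤ ‖Ψ‖²₁`) and
  ★★★ **`hs_restrict_GpY_parSymY_le`**:
  `G ≤ U(N)`, `N ≥ 1`, `0 ≤ c·M·α₀`, `c·M·α₀·(d+1) ≤ 1∕16`, `U ∈ Reg335 c α₀`; finite site sets `A, B`; `Ψ` vanishing off `B`; a weight `ω > 0` with `ω = 1` on
  `B`, `ω ≥ W > 0` on `A`, bond ratios `q(ω(z+e_μ), ω z) ≤ θ_b·m` (both ends), block oscillation `q ≤ θ_s`, `(d+1)θ_b + θ_s∕2 ≤ 1∕16`; levels `≤ j_A` on `A`,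
  `≤ j_B` on `B`.  THEN `Σ_{z∈A} HS((G′(U)Ψ)(z)) ≤ 256·((L^{j_A})²·(L^{j_B})²∕W²)·‖Ψ‖²₁`.
MODEL ∕ DECLARED READINGS.  (M1)–(M3) as files 3c∕4 (def-Y's letters `GpY i (parSymY i) U`, fibre `M_N(ℂ)`, `trIP 1`, lattice units of the member: `L^{j}` is
print's `Lʲη·η⁻¹`).  (M4) THE WEIGHT IS A PARAMETER: print's `e^{−δ₀d(y,y′)}` is obtained in file 7 by `ω = e^{δρ}` with `ρ` any site function that is
`L^{−lev}`-Lipschitz across bonds and has oscillation `≤ d+1` on blocks (print's weighted distance to `supp λ` is such a `ρ`; that identification over `{Ω_j}`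
is a geometric lemma NOT proved here).  (M5) `‖1_A G′ 1_B‖` is stated as the `HS`-sum over `A` of `G′Ψ` for `Ψ` supported in `B` (no operator norm on `End`
is introduced).  NOT HERE: the sup-norm ∕ Hölder inequalities (3.42)–(3.45), the derivative companions of (3.46), (3.47), the bond sector.  NON-VACUITY (A6):
the class is inhabited (`reg335_one`, pure gauges); `ω ≡ 1` (θ_b = θ_s = 0, W = 1) is an admissible weight, for which the theorem is file 4's norm bound
localised; file 7 exhibits the non-trivial weights.
HONEST SCOPE.  A decay estimate for one finite lattice operator at a time, constants explicit; NOT a node discharge, NOT summit progress; count-neutral;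
nothing continuum ∕ OS ∕ mass gap ∕ Clay.  NEW file importing file 5b and dag-n06-j's `B9Thm311FlippedBondLetters` (for `hs_real_smul`) only; nothing landed is modified.  Net new unproved facts: 0.
-/

noncomputable section

namespace Literature.MathematicalPhysics.QuantumFieldTheory.Balaban1983to89.B9Thm31SiteGpDecayReg335Y

open Literature.MathematicalPhysics.QuantumFieldTheory.Balaban1983to89
open Node00 B6KLevelCensusIndexV1 B6Geom246MultiLevelBox B6MultiLevelBoxOperator B6MultiLevelTorusOperator B6GlobalChartV1 B9BackgroundsKLevelV1
  B9Eq39Adjoint B9Thm311ReadingCoords B9Thm311DeltaPrimePos B9Ineq369CurvatureSmallAtLettersY B9Thm31SiteCoerciveGaugeBlockY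
  B9Thm31SiteCoerciveReg335Y B9Thm31SiteGpBoundsReg335Y B9Thm31SitePolarisedFormY B9Thm31SiteConjugatedFormY
open Literature.MathematicalPhysics.QuantumFieldTheory.Balaban1983to89.B9Ineq349SiteAdjoint (trIP_comm)
open Literature.MathematicalPhysics.QuantumFieldTheory.Balaban1983to89.B9Thm311DeltaPrimeSymm (trIP_one_eq)
open Literature.MathematicalPhysics.QuantumFieldTheory.Balaban1983to89.B9Thm311FlippedBondLetters (hs_real_smul)
open scoped Matrix Matrix.Norms.L2Operator

variable {d ℓ : ℕ} {hd : 1 ≤ d + 1} {hL : Odd (ℓ + 1) ∧ 1 < ℓ + 1} {b₀ b₁ : ℝ}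
variable (i : KIdx d ℓ hd hL b₀ b₁) {N : ℕ} {G : Subgroup (Matrix (Fin N) (Fin N) ℂ)ˣ}

/-! ## §1 The conjugated coercivity on the class -/

/-- ★★ **THE CONJUGATED COERCIVITY OF `Δ′_a(U)` ON THE CLASS (3.35)**: `G ≤ U(N)`, `N ≥ 1`, `0 ≤ c·M·α₀`, `c·M·α₀·(d+1) ≤ 1∕16`, `U ∈ Reg335 c α₀`; a weight
`ω > 0` with bond ratios `q ≤ θ_b·(L^{lev})⁻²` (both ends) and block oscillation `q ≤ θ_s`.  Then
`(1∕8 − ((d+1)θ_b + θ_s∕2))·Σ_z (L^{lev z})⁻²·HS(Φ z) ≤ ⟨ωΦ, Δ′_a(U)(ω⁻¹Φ)⟩₁`. [cite: Agmon1982, Ch.1, Thm 1.5; Balaban1985BackgroundPropagators, Thm 3.1 p.397, (3.24) p.394, (3.35) p.396] -/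
theorem trIP_wsmul_deltaPrimeAY_winv_ge_levelMass [Nonempty (Fin N)] (hG : G ≤ B7Prop2Explicit.unitaryUnits (Matrix (Fin N) (Fin N) ℂ))
    {U : CfgY (Matrix (Fin N) (Fin N) ℂ) i} {c α₀ : ℝ} (hC0 : 0 ≤ c * (kGeo i).M * α₀) (hC1 : c * (kGeo i).M * α₀ * ((d : ℝ) + 1) ≤ 1 / 16)
    (hreg : (bg9K (Matrix (Fin N) (Fin N) ℂ) G i).Reg335 c α₀ U) {ω : SiteY i → ℝ} (hω : ∀ z, 0 < ω z) {θb θs : ℝ}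
    (hb1 : ∀ μ z, ω (shiftY i μ z) / ω z + ω z / ω (shiftY i μ z) - 2 ≤ θb * (((((ℓ + 1) ^ (blkOf i.D.toDomains z).1.1 : ℕ) : ℝ)) ^ 2)⁻¹)
    (hb2 : ∀ μ z, ω (shiftY i μ z) / ω z + ω z / ω (shiftY i μ z) - 2 ≤ θb * (((((ℓ + 1) ^ (blkOf i.D.toDomains (shiftY i μ z)).1.1 : ℕ) : ℝ)) ^ 2)⁻¹)
    (hs : ∀ z w : SiteY i, blkOf i.D.toDomains w = blkOf i.D.toDomains z → ω z / ω w + ω w / ω z - 2 ≤ θs)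
    (Φ : SiteY i → Matrix (Fin N) (Fin N) ℂ) :
    (1 / 8 - (((d : ℝ) + 1) * θb + θs / 2)) * ∑ z : SiteY i, (((((ℓ + 1) ^ (blkOf i.D.toDomains z).1.1 : ℕ) : ℝ)) ^ 2)⁻¹ * ∑ a, ∑ b, ‖Φ z a b‖ ^ 2
      ≤ trIP (fun _ => (1 : ℝ)) (fun z => ((ω z : ℝ) : ℂ) • Φ z) (deltaPrimeAY i (parSymY i) U (fun z => (((ω z)⁻¹ : ℝ) : ℂ) • Φ z)) := by
  have hU : ∀ μ x, U μ x ∈ G := hreg.1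
  have h1 := trIP_deltaPrimeAY_parSymY_ge_levelMass i hG hC0 hC1 hreg Φ
  have h2 := trIP_wsmul_deltaPrimeAY_winv_ge i hG (parSymY i) U (parSymY_inv_symm U) (fun z w => parSymY_mem i hU z w) hU hω hb1 hb2 hs Φ
  rw [sub_mul]
  linarith

/-! ## §2 Agmon's bound: the `L²`-local decay of `G′(U)` -/

/-- the pairing of `ω²Φ` against a field supported where `ω = 1` is the plain pairing. [cite: Agmon1982, Ch.1, bookkeeping] -/
theorem trIP_wsq_eq_of_support {ω : SiteY i → ℝ} {B : Finset (SiteY i)} (hωB : ∀ z ∈ B, ω z = 1) {Ψ : SiteY i → Matrix (Fin N) (Fin N) ℂ}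
    (hΨ : ∀ z, z ∉ B → Ψ z = 0) (Φ : SiteY i → Matrix (Fin N) (Fin N) ℂ) :
    trIP (fun _ => (1 : ℝ)) (fun z => ((ω z : ℝ) : ℂ) • (((ω z : ℝ) : ℂ) • Φ z)) Ψ = trIP (fun _ => (1 : ℝ)) Φ Ψ := by
  rw [trIP_one_eq, trIP_one_eq, Complex.re_sum, Complex.re_sum]
  refine Finset.sum_congr rfl fun z _ => ?_
  by_cases hz : z ∈ B
  · rw [hωB z hz, Complex.ofReal_one, one_smul, one_smul]
  · rw [hΨ z hz, Matrix.mul_zero, Matrix.mul_zero]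

/-- Cauchy–Schwarz against a field supported in `B`: `|⟨Φ, Ψ⟩₁| ≤ √(Σ_{z∈B}HS(Φ z))·‖Ψ‖₁`. [cite: Agmon1982, Ch.1, bookkeeping] -/
theorem abs_trIP_le_of_support {B : Finset (SiteY i)} {Ψ : SiteY i → Matrix (Fin N) (Fin N) ℂ} (hΨ : ∀ z, z ∉ B → Ψ z = 0)
    (Φ : SiteY i → Matrix (Fin N) (Fin N) ℂ) :
    |trIP (fun _ => (1 : ℝ)) Φ Ψ| ≤ Real.sqrt (∑ z ∈ B, ∑ a, ∑ b, ‖Φ z a b‖ ^ 2) * Real.sqrt (trIP (fun _ => (1 : ℝ)) Ψ Ψ) := by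
  classical
  set ΦB : SiteY i → Matrix (Fin N) (Fin N) ℂ := fun z => if z ∈ B then Φ z else 0 with hΦB
  have heq : trIP (fun _ => (1 : ℝ)) Φ Ψ = trIP (fun _ => (1 : ℝ)) ΦB Ψ := by
    rw [trIP_one_eq, trIP_one_eq]
    congr 1
    refine Finset.sum_congr rfl fun z _ => ?_
    by_cases hz : z ∈ B
    · simp only [hΦB, hz, if_true]
    · rw [hΨ z hz, Matrix.mul_zero, Matrix.mul_zero]
  have hB : trIP (fun _ => (1 : ℝ)) ΦB ΦB = ∑ z ∈ B, ∑ a, ∑ b, ‖Φ z a b‖ ^ 2 := by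
    rw [trIP_one_self_eq, ← Finset.sum_filter_add_sum_filter_not Finset.univ (fun z => z ∈ B)]
    have h0 : ∑ z ∈ Finset.univ.filter (fun z => ¬ z ∈ B), ∑ a, ∑ b, ‖ΦB z a b‖ ^ 2 = 0 :=
      Finset.sum_eq_zero fun z hz => by
        have hz' : z ∉ B := (Finset.mem_filter.1 hz).2
        simp only [hΦB, hz', if_false, Matrix.zero_apply, norm_zero]
        simp
    rw [h0, add_zero, Finset.filter_mem_eq_inter, Finset.univ_inter]
    refine Finset.sum_congr rfl fun z hz => ?_
    simp only [hΦB, hz, if_true]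
  rw [heq, ← hB]
  exact abs_trIP_le _ (fun _ => one_pos) ΦB Ψ

/-- reading the level-weighted mass of `ωΦ` on a finite set of sites of level `≤ j` where `ω ≥ W ≥ 0`: `(L^j)⁻²·W²·Σ_{z∈A}HS(Φ z) ≤ Σ_z m_z·HS(ω_zΦ z)`.
[cite: Agmon1982, Ch.1, bookkeeping; Balaban1984PropagatorsII, (2.3)–(2.4) p.224] -/
theorem sum_filter_hs_le_levelMass (ω : SiteY i → ℝ) {A : Finset (SiteY i)} {jA : ℕ} (hjA : ∀ z ∈ A, (blkOf i.D.toDomains z).1.1 ≤ jA)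
    {W : ℝ} (hW0 : 0 ≤ W) (hW : ∀ z ∈ A, W ≤ ω z) (Φ : SiteY i → Matrix (Fin N) (Fin N) ℂ) :
    (((((ℓ + 1) ^ jA : ℕ) : ℝ)) ^ 2)⁻¹ * W ^ 2 * ∑ z ∈ A, ∑ a, ∑ b, ‖Φ z a b‖ ^ 2
      ≤ ∑ z : SiteY i, (((((ℓ + 1) ^ (blkOf i.D.toDomains z).1.1 : ℕ) : ℝ)) ^ 2)⁻¹ * ∑ a, ∑ b, ‖(((ω z : ℝ) : ℂ) • Φ z) a b‖ ^ 2 := by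
  have hterm : ∀ z, 0 ≤ (((((ℓ + 1) ^ (blkOf i.D.toDomains z).1.1 : ℕ) : ℝ)) ^ 2)⁻¹ * ∑ a, ∑ b, ‖(((ω z : ℝ) : ℂ) • Φ z) a b‖ ^ 2 :=
    fun z => mul_nonneg (inv_nonneg.2 (by positivity)) (hs_nonneg _)
  calc (((((ℓ + 1) ^ jA : ℕ) : ℝ)) ^ 2)⁻¹ * W ^ 2 * ∑ z ∈ A, ∑ a, ∑ b, ‖Φ z a b‖ ^ 2
      = ∑ z ∈ A, (((((ℓ + 1) ^ jA : ℕ) : ℝ)) ^ 2)⁻¹ * (W ^ 2 * ∑ a, ∑ b, ‖Φ z a b‖ ^ 2) := by rw [Finset.mul_sum]; exact Finset.sum_congr rfl fun z _ => by ring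
    _ ≤ ∑ z ∈ A, (((((ℓ + 1) ^ (blkOf i.D.toDomains z).1.1 : ℕ) : ℝ)) ^ 2)⁻¹ * ∑ a, ∑ b, ‖(((ω z : ℝ) : ℂ) • Φ z) a b‖ ^ 2 := by
        refine Finset.sum_le_sum fun z hz => ?_
        have hX := hs_nonneg (Φ z)
        have hpow : (((ℓ + 1) ^ (blkOf i.D.toDomains z).1.1 : ℕ) : ℝ) ≤ (((ℓ + 1) ^ jA : ℕ) : ℝ) := by
          exact_mod_cast Nat.pow_le_pow_right (Nat.succ_pos ℓ) (hjA z hz)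
        have hpos : (0 : ℝ) < (((ℓ + 1) ^ (blkOf i.D.toDomains z).1.1 : ℕ) : ℝ) := by positivity
        have hinv : (((((ℓ + 1) ^ jA : ℕ) : ℝ)) ^ 2)⁻¹ ≤ (((((ℓ + 1) ^ (blkOf i.D.toDomains z).1.1 : ℕ) : ℝ)) ^ 2)⁻¹ :=
          inv_anti₀ (by positivity) (pow_le_pow_left₀ hpos.le hpow 2)
        have hw2 : W ^ 2 ≤ ω z ^ 2 := pow_le_pow_left₀ hW0 (hW z hz) 2
        rw [hs_real_smul]
        exact mul_le_mul hinv (mul_le_mul_of_nonneg_right hw2 hX) (by positivity) (inv_nonneg.2 (by positivity))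
    _ ≤ ∑ z, (((((ℓ + 1) ^ (blkOf i.D.toDomains z).1.1 : ℕ) : ℝ)) ^ 2)⁻¹ * ∑ a, ∑ b, ‖(((ω z : ℝ) : ℂ) • Φ z) a b‖ ^ 2 :=
        Finset.sum_le_univ_sum_of_nonneg fun z => hterm z

/-- AGMON'S ARITHMETIC, STEP 1: from `c₀M ≤ X`, `X² ≤ P_B·Q`, `m_B P_B ≤ M` (`P_B, Q ≥ 0`, `c₀, m_B > 0`) conclude `c₀·m_B·X ≤ Q`.
[cite: Agmon1982, Ch.1, Thm 1.5, bookkeeping] -/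
theorem agmon_arith_pairing {c₀ mB PB Q M X : ℝ} (hc₀ : 0 < c₀) (hmB : 0 < mB) (hPB : 0 ≤ PB) (hQ : 0 ≤ Q)
    (hiX : c₀ * M ≤ X) (hX2 : X ^ 2 ≤ PB * Q) (hMB : mB * PB ≤ M) : c₀ * mB * X ≤ Q := by
  have hM0 : 0 ≤ M := le_trans (mul_nonneg hmB.le hPB) hMB
  have hX0 : 0 ≤ X := le_trans (mul_nonneg hc₀.le hM0) hiX
  have h4 : c₀ * mB * PB ≤ X := by
    calc c₀ * mB * PB = c₀ * (mB * PB) := by ring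
      _ ≤ c₀ * M := mul_le_mul_of_nonneg_left hMB hc₀.le
      _ ≤ X := hiX
  have hPBQ : c₀ ^ 2 * mB ^ 2 * PB ≤ Q := by
    have h3 : (c₀ * mB * PB) ^ 2 ≤ PB * Q := le_trans (pow_le_pow_left₀ (by positivity) h4 2) hX2
    rcases hPB.eq_or_lt with h0 | hpos
    · rw [← h0, mul_zero]; exact hQ
    · have h5 : c₀ ^ 2 * mB ^ 2 * PB * PB ≤ Q * PB := by
        calc c₀ ^ 2 * mB ^ 2 * PB * PB = (c₀ * mB * PB) ^ 2 := by ring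
          _ ≤ PB * Q := h3
          _ = Q * PB := mul_comm _ _
      exact le_of_mul_le_mul_right h5 hpos
  have hXQ : (c₀ * mB * X) ^ 2 ≤ Q ^ 2 := by
    calc (c₀ * mB * X) ^ 2 = c₀ ^ 2 * mB ^ 2 * X ^ 2 := by ring
      _ ≤ c₀ ^ 2 * mB ^ 2 * (PB * Q) := mul_le_mul_of_nonneg_left hX2 (by positivity)
      _ = (c₀ ^ 2 * mB ^ 2 * PB) * Q := by ring
      _ ≤ Q * Q := mul_le_mul_of_nonneg_right hPBQ hQ
      _ = Q ^ 2 := (sq Q).symm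
  exact (pow_le_pow_iff_left₀ (mul_nonneg (mul_nonneg hc₀.le hmB.le) hX0) hQ two_ne_zero).1 hXQ

/-- AGMON'S ARITHMETIC, STEP 2: with moreover `m_A W² P_A ≤ M`: `c₀²·m_A·m_B·W²·P_A ≤ Q`. [cite: Agmon1982, Ch.1, Thm 1.5, bookkeeping] -/
theorem agmon_arith {c₀ mA mB W PA PB Q M X : ℝ} (hc₀ : 0 < c₀) (hmB : 0 < mB) (hPB : 0 ≤ PB) (hQ : 0 ≤ Q)
    (hiX : c₀ * M ≤ X) (hX2 : X ^ 2 ≤ PB * Q) (hMB : mB * PB ≤ M) (hMA : mA * W ^ 2 * PA ≤ M) : c₀ ^ 2 * mA * mB * W ^ 2 * PA ≤ Q := by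
  have h5 : c₀ * (mA * W ^ 2 * PA) ≤ X := le_trans (mul_le_mul_of_nonneg_left hMA hc₀.le) hiX
  calc c₀ ^ 2 * mA * mB * W ^ 2 * PA = c₀ * mB * (c₀ * (mA * W ^ 2 * PA)) := by ring
    _ ≤ c₀ * mB * X := mul_le_mul_of_nonneg_left h5 (mul_nonneg hc₀.le hmB.le)
    _ ≤ Q := agmon_arith_pairing hc₀ hmB hPB hQ hiX hX2 hMB

/-- unpacking the constants: with `m_A = (L_A²)⁻¹`, `m_B = (L_B²)⁻¹`, `c₀ ≥ 1∕16`, `W > 0`: `c₀²m_Am_BW²P_A ≤ Q ⇒ P_A ≤ 256·(L_A²L_B²∕W²)·Q`.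
[cite: Agmon1982, Ch.1, bookkeeping] -/
theorem agmon_unpack {c₀ LA LB W PA Q : ℝ} (hc₀ : 1 / 16 ≤ c₀) (hLA : 0 < LA) (hLB : 0 < LB) (hW : 0 < W) (hQ : 0 ≤ Q)
    (h : c₀ ^ 2 * (LA ^ 2)⁻¹ * (LB ^ 2)⁻¹ * W ^ 2 * PA ≤ Q) : PA ≤ 256 * (LA ^ 2 * LB ^ 2 / W ^ 2) * Q := by
  have hc₀0 : 0 < c₀ := lt_of_lt_of_le (by norm_num) hc₀
  have e : (c₀ ^ 2)⁻¹ * (LA ^ 2 * LB ^ 2 / W ^ 2) * (c₀ ^ 2 * (LA ^ 2)⁻¹ * (LB ^ 2)⁻¹ * W ^ 2 * PA) = PA := by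
    field_simp
  have hkey : PA ≤ (c₀ ^ 2)⁻¹ * (LA ^ 2 * LB ^ 2 / W ^ 2) * Q := by
    calc PA = (c₀ ^ 2)⁻¹ * (LA ^ 2 * LB ^ 2 / W ^ 2) * (c₀ ^ 2 * (LA ^ 2)⁻¹ * (LB ^ 2)⁻¹ * W ^ 2 * PA) := e.symm
      _ ≤ (c₀ ^ 2)⁻¹ * (LA ^ 2 * LB ^ 2 / W ^ 2) * Q := mul_le_mul_of_nonneg_left h (by positivity)
  have hc2 : (c₀ ^ 2)⁻¹ ≤ 256 := by
    have h16 : (1 / 16 : ℝ) ^ 2 ≤ c₀ ^ 2 := pow_le_pow_left₀ (by norm_num) hc₀ 2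
    calc (c₀ ^ 2)⁻¹ ≤ ((1 / 16 : ℝ) ^ 2)⁻¹ := inv_anti₀ (by positivity) h16
      _ = 256 := by norm_num
  exact hkey.trans (mul_le_mul_of_nonneg_right (mul_le_mul_of_nonneg_right hc2 (by positivity)) hQ)

/-- at `Φ = G′(U)Ψ` with `Ψ` supported where `ω = 1`, THE CONJUGATED FORM OF `ωΦ` IS THE PLAIN PAIRING: `⟨ω(ωΦ), Δ′_a(U)(ω⁻¹(ωΦ))⟩₁ = ⟨Φ, Ψ⟩₁`
(`G`-valued `U`, `G ≤ U(N)`; no smallness). [cite: Agmon1982, Ch.1; Balaban1985BackgroundPropagators, (3.25) p.395] -/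
theorem conj_wsmul_GpY_eq_pairing (hG : G ≤ B7Prop2Explicit.unitaryUnits (Matrix (Fin N) (Fin N) ℂ)) {U : CfgY (Matrix (Fin N) (Fin N) ℂ) i}
    (hU : ∀ μ x, U μ x ∈ G) {ω : SiteY i → ℝ} (hω : ∀ z, 0 < ω z) {B : Finset (SiteY i)} {Ψ : SiteY i → Matrix (Fin N) (Fin N) ℂ}
    (hΨ : ∀ z, z ∉ B → Ψ z = 0) (hωB : ∀ z ∈ B, ω z = 1) :
    trIP (fun _ => (1 : ℝ)) (fun z => ((ω z : ℝ) : ℂ) • (((ω z : ℝ) : ℂ) • GpY i (parSymY i) U Ψ z))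
        (deltaPrimeAY i (parSymY i) U (fun z => (((ω z)⁻¹ : ℝ) : ℂ) • (((ω z : ℝ) : ℂ) • GpY i (parSymY i) U Ψ z)))
      = trIP (fun _ => (1 : ℝ)) (GpY i (parSymY i) U Ψ) Ψ := by
  have hunit : IsUnit (deltaPrimeAY i (parSymY i) U) := isUnit_deltaPrimeAY_parSymY i hG hU
  have hinvΦ : (fun z => (((ω z)⁻¹ : ℝ) : ℂ) • (((ω z : ℝ) : ℂ) • GpY i (parSymY i) U Ψ z)) = GpY i (parSymY i) U Ψ := by
    funext z
    rw [smul_smul, ← Complex.ofReal_mul, inv_mul_cancel₀ (hω z).ne', Complex.ofReal_one, one_smul]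
  have hΔΦ : deltaPrimeAY i (parSymY i) U (GpY i (parSymY i) U Ψ) = Ψ := apply_inverse_of_isUnit hunit Ψ
  rw [hinvΦ, hΔΦ, trIP_wsq_eq_of_support i hωB hΨ]

/-- ★★ **AGMON'S FIRST READING**: on the class, for `Ψ` vanishing off `B`, a weight `ω > 0` with `ω = 1` on `B` meeting the bond∕block hypotheses with
`(d+1)θ_b + θ_s∕2 ≤ 1∕16`, and `Φ := G′(U)Ψ`: `(1∕8 − (d+1)θ_b − θ_s∕2)·Σ_z m_z·HS(ω_z·Φ z) ≤ ⟨Φ, Ψ⟩₁` — the conjugated form at `ωΦ` IS the plain pairing.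
[cite: Agmon1982, Ch.1, Thm 1.5; Balaban1985BackgroundPropagators, Thm 3.1 (3.46) p.398] -/
theorem levelMass_wsmul_GpY_le_pairing [Nonempty (Fin N)] (hG : G ≤ B7Prop2Explicit.unitaryUnits (Matrix (Fin N) (Fin N) ℂ))
    {U : CfgY (Matrix (Fin N) (Fin N) ℂ) i} {c α₀ : ℝ} (hC0 : 0 ≤ c * (kGeo i).M * α₀) (hC1 : c * (kGeo i).M * α₀ * ((d : ℝ) + 1) ≤ 1 / 16)
    (hreg : (bg9K (Matrix (Fin N) (Fin N) ℂ) G i).Reg335 c α₀ U) {ω : SiteY i → ℝ} (hω : ∀ z, 0 < ω z) {θb θs : ℝ}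
    (hb1 : ∀ μ z, ω (shiftY i μ z) / ω z + ω z / ω (shiftY i μ z) - 2 ≤ θb * (((((ℓ + 1) ^ (blkOf i.D.toDomains z).1.1 : ℕ) : ℝ)) ^ 2)⁻¹)
    (hb2 : ∀ μ z, ω (shiftY i μ z) / ω z + ω z / ω (shiftY i μ z) - 2 ≤ θb * (((((ℓ + 1) ^ (blkOf i.D.toDomains (shiftY i μ z)).1.1 : ℕ) : ℝ)) ^ 2)⁻¹)
    (hs : ∀ z w : SiteY i, blkOf i.D.toDomains w = blkOf i.D.toDomains z → ω z / ω w + ω w / ω z - 2 ≤ θs)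
    {B : Finset (SiteY i)} {Ψ : SiteY i → Matrix (Fin N) (Fin N) ℂ} (hΨ : ∀ z, z ∉ B → Ψ z = 0) (hωB : ∀ z ∈ B, ω z = 1) :
    (1 / 8 - (((d : ℝ) + 1) * θb + θs / 2)) *
        ∑ z : SiteY i, (((((ℓ + 1) ^ (blkOf i.D.toDomains z).1.1 : ℕ) : ℝ)) ^ 2)⁻¹ * ∑ a, ∑ b, ‖(((ω z : ℝ) : ℂ) • GpY i (parSymY i) U Ψ z) a b‖ ^ 2
      ≤ trIP (fun _ => (1 : ℝ)) (GpY i (parSymY i) U Ψ) Ψ := by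
  have hconj := trIP_wsmul_deltaPrimeAY_winv_ge_levelMass i hG hC0 hC1 hreg hω hb1 hb2 hs (fun z => ((ω z : ℝ) : ℂ) • GpY i (parSymY i) U Ψ z)
  rwa [conj_wsmul_GpY_eq_pairing i hG hreg.1 hω hΨ hωB] at hconj

/-- ★★ **AGMON'S SECOND READING**: under the same hypotheses and levels `≤ j_B` on `B`: `(1∕8 − (d+1)θ_b − θ_s∕2)·(L^{j_B})⁻²·⟨G′(U)Ψ, Ψ⟩₁ ≤ ‖Ψ‖²₁`
(read the mass on `B` where `ω = 1`, then Cauchy–Schwarz against the support). [cite: Agmon1982, Ch.1, Thm 1.5; Balaban1985BackgroundPropagators, Thm 3.1 (3.46) p.398] -/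
theorem pairing_GpY_le_of_support [Nonempty (Fin N)] (hG : G ≤ B7Prop2Explicit.unitaryUnits (Matrix (Fin N) (Fin N) ℂ))
    {U : CfgY (Matrix (Fin N) (Fin N) ℂ) i} {c α₀ : ℝ} (hC0 : 0 ≤ c * (kGeo i).M * α₀) (hC1 : c * (kGeo i).M * α₀ * ((d : ℝ) + 1) ≤ 1 / 16)
    (hreg : (bg9K (Matrix (Fin N) (Fin N) ℂ) G i).Reg335 c α₀ U) {ω : SiteY i → ℝ} (hω : ∀ z, 0 < ω z) {θb θs : ℝ}
    (hb1 : ∀ μ z, ω (shiftY i μ z) / ω z + ω z / ω (shiftY i μ z) - 2 ≤ θb * (((((ℓ + 1) ^ (blkOf i.D.toDomains z).1.1 : ℕ) : ℝ)) ^ 2)⁻¹)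
    (hb2 : ∀ μ z, ω (shiftY i μ z) / ω z + ω z / ω (shiftY i μ z) - 2 ≤ θb * (((((ℓ + 1) ^ (blkOf i.D.toDomains (shiftY i μ z)).1.1 : ℕ) : ℝ)) ^ 2)⁻¹)
    (hs : ∀ z w : SiteY i, blkOf i.D.toDomains w = blkOf i.D.toDomains z → ω z / ω w + ω w / ω z - 2 ≤ θs)
    (hκ : ((d : ℝ) + 1) * θb + θs / 2 ≤ 1 / 16)
    {B : Finset (SiteY i)} {Ψ : SiteY i → Matrix (Fin N) (Fin N) ℂ} (hΨ : ∀ z, z ∉ B → Ψ z = 0) (hωB : ∀ z ∈ B, ω z = 1)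
    {jB : ℕ} (hjB : ∀ z ∈ B, (blkOf i.D.toDomains z).1.1 ≤ jB) :
    (1 / 8 - (((d : ℝ) + 1) * θb + θs / 2)) * (((((ℓ + 1) ^ jB : ℕ) : ℝ)) ^ 2)⁻¹ * trIP (fun _ => (1 : ℝ)) (GpY i (parSymY i) U Ψ) Ψ
      ≤ trIP (fun _ => (1 : ℝ)) Ψ Ψ := by
  have hc₀0 : 0 < 1 / 8 - (((d : ℝ) + 1) * θb + θs / 2) := by linarith
  have hiX := levelMass_wsmul_GpY_le_pairing i hG hC0 hC1 hreg hω hb1 hb2 hs hΨ hωB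
  have hPB0 : 0 ≤ ∑ z ∈ B, ∑ a, ∑ b, ‖GpY i (parSymY i) U Ψ z a b‖ ^ 2 := Finset.sum_nonneg fun _ _ => hs_nonneg _
  have hQ0 : 0 ≤ trIP (fun _ => (1 : ℝ)) Ψ Ψ := trIP_self_nonneg _ (fun _ => one_pos) Ψ
  have hX2 : trIP (fun _ => (1 : ℝ)) (GpY i (parSymY i) U Ψ) Ψ ^ 2
      ≤ (∑ z ∈ B, ∑ a, ∑ b, ‖GpY i (parSymY i) U Ψ z a b‖ ^ 2) * trIP (fun _ => (1 : ℝ)) Ψ Ψ := by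
    have h := abs_trIP_le_of_support i hΨ (GpY i (parSymY i) U Ψ)
    calc trIP (fun _ => (1 : ℝ)) (GpY i (parSymY i) U Ψ) Ψ ^ 2 = |trIP (fun _ => (1 : ℝ)) (GpY i (parSymY i) U Ψ) Ψ| ^ 2 := (sq_abs _).symm
      _ ≤ (Real.sqrt (∑ z ∈ B, ∑ a, ∑ b, ‖GpY i (parSymY i) U Ψ z a b‖ ^ 2) * Real.sqrt (trIP (fun _ => (1 : ℝ)) Ψ Ψ)) ^ 2 :=
          pow_le_pow_left₀ (abs_nonneg _) h 2
      _ = _ := by rw [mul_pow, Real.sq_sqrt hPB0, Real.sq_sqrt hQ0]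
  have hMB := sum_filter_hs_le_levelMass i ω hjB zero_le_one (fun z hz => (hωB z hz).ge) (GpY i (parSymY i) U Ψ)
  rw [one_pow, mul_one] at hMB
  exact agmon_arith_pairing hc₀0 (inv_pos.2 (by positivity)) hPB0 hQ0 hiX hX2 hMB

/-- ★★★ **THE `L²`-LOCAL DECAY OF `G′(U)` ON THE CLASS (3.35) — (3.46a)'s SHAPE BY AGMON'S METHOD.**  `G ≤ U(N)`, `N ≥ 1`, `0 ≤ c·M·α₀`,
`c·M·α₀·(d+1) ≤ 1∕16`, `U ∈ (bg9K (M_N ℂ) G i).Reg335 c α₀`; finite site sets `A`, `B`; `Ψ` vanishing off `B`; a weight `ω > 0` with `ω = 1` on `B`, `ω ≥ W > 0`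
on `A`, bond ratios `q(ω(z+e_μ), ω z) ≤ θ_b·(L^{lev})⁻²` (both ends), block oscillation `q ≤ θ_s`, `(d+1)θ_b + θ_s∕2 ≤ 1∕16`; levels `≤ j_A` on `A`, `≤ j_B`
on `B`.  THEN `Σ_{z∈A} HS((G′(U)Ψ)(z)) ≤ 256·((L^{j_A})²(L^{j_B})²∕W²)·‖Ψ‖²₁` — i.e. `‖1_A G′(U) 1_B‖ ≤ 16·L^{j_A}L^{j_B}·W⁻¹`, print's
`B₀(Lʲη)(Lʲ′η)e^{−δ₀d(y,y′)}` with `B₀ = 16` once `W = e^{δ₀d}` (file 7), member-∕volume-∕k-∕N-∕U-uniformly.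
[cite: Balaban1985BackgroundPropagators, Thm 3.1 (3.46) p.398, (3.35) p.396; Agmon1982, Ch.1, Thm 1.5; CombesThomas1973] -/
theorem hs_restrict_GpY_parSymY_le [Nonempty (Fin N)] (hG : G ≤ B7Prop2Explicit.unitaryUnits (Matrix (Fin N) (Fin N) ℂ))
    {U : CfgY (Matrix (Fin N) (Fin N) ℂ) i} {c α₀ : ℝ} (hC0 : 0 ≤ c * (kGeo i).M * α₀) (hC1 : c * (kGeo i).M * α₀ * ((d : ℝ) + 1) ≤ 1 / 16)
    (hreg : (bg9K (Matrix (Fin N) (Fin N) ℂ) G i).Reg335 c α₀ U) {ω : SiteY i → ℝ} (hω : ∀ z, 0 < ω z) {θb θs : ℝ}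
    (hb1 : ∀ μ z, ω (shiftY i μ z) / ω z + ω z / ω (shiftY i μ z) - 2 ≤ θb * (((((ℓ + 1) ^ (blkOf i.D.toDomains z).1.1 : ℕ) : ℝ)) ^ 2)⁻¹)
    (hb2 : ∀ μ z, ω (shiftY i μ z) / ω z + ω z / ω (shiftY i μ z) - 2 ≤ θb * (((((ℓ + 1) ^ (blkOf i.D.toDomains (shiftY i μ z)).1.1 : ℕ) : ℝ)) ^ 2)⁻¹)
    (hs : ∀ z w : SiteY i, blkOf i.D.toDomains w = blkOf i.D.toDomains z → ω z / ω w + ω w / ω z - 2 ≤ θs)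
    (hκ : ((d : ℝ) + 1) * θb + θs / 2 ≤ 1 / 16)
    {A B : Finset (SiteY i)} {Ψ : SiteY i → Matrix (Fin N) (Fin N) ℂ} (hΨ : ∀ z, z ∉ B → Ψ z = 0) (hωB : ∀ z ∈ B, ω z = 1)
    {jA jB : ℕ} (hjA : ∀ z ∈ A, (blkOf i.D.toDomains z).1.1 ≤ jA) (hjB : ∀ z ∈ B, (blkOf i.D.toDomains z).1.1 ≤ jB)
    {W : ℝ} (hW0 : 0 < W) (hW : ∀ z ∈ A, W ≤ ω z) :
    ∑ z ∈ A, ∑ a, ∑ b, ‖GpY i (parSymY i) U Ψ z a b‖ ^ 2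
      ≤ 256 * (((((ℓ + 1) ^ jA : ℕ) : ℝ)) ^ 2 * ((((ℓ + 1) ^ jB : ℕ) : ℝ)) ^ 2 / W ^ 2) * trIP (fun _ => (1 : ℝ)) Ψ Ψ := by
  have hc₀pos : 1 / 16 ≤ 1 / 8 - (((d : ℝ) + 1) * θb + θs / 2) := by linarith
  have hc₀0 : 0 < 1 / 8 - (((d : ℝ) + 1) * θb + θs / 2) := lt_of_lt_of_le (by norm_num) hc₀pos
  have hiX := levelMass_wsmul_GpY_le_pairing i hG hC0 hC1 hreg hω hb1 hb2 hs hΨ hωB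
  have hPB0 : 0 ≤ ∑ z ∈ B, ∑ a, ∑ b, ‖GpY i (parSymY i) U Ψ z a b‖ ^ 2 := Finset.sum_nonneg fun _ _ => hs_nonneg _
  have hQ0 : 0 ≤ trIP (fun _ => (1 : ℝ)) Ψ Ψ := trIP_self_nonneg _ (fun _ => one_pos) Ψ
  have hX2 : trIP (fun _ => (1 : ℝ)) (GpY i (parSymY i) U Ψ) Ψ ^ 2
      ≤ (∑ z ∈ B, ∑ a, ∑ b, ‖GpY i (parSymY i) U Ψ z a b‖ ^ 2) * trIP (fun _ => (1 : ℝ)) Ψ Ψ := by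
    have h := abs_trIP_le_of_support i hΨ (GpY i (parSymY i) U Ψ)
    calc trIP (fun _ => (1 : ℝ)) (GpY i (parSymY i) U Ψ) Ψ ^ 2 = |trIP (fun _ => (1 : ℝ)) (GpY i (parSymY i) U Ψ) Ψ| ^ 2 := (sq_abs _).symm
      _ ≤ (Real.sqrt (∑ z ∈ B, ∑ a, ∑ b, ‖GpY i (parSymY i) U Ψ z a b‖ ^ 2) * Real.sqrt (trIP (fun _ => (1 : ℝ)) Ψ Ψ)) ^ 2 :=
          pow_le_pow_left₀ (abs_nonneg _) h 2
      _ = _ := by rw [mul_pow, Real.sq_sqrt hPB0, Real.sq_sqrt hQ0]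
  have hMB := sum_filter_hs_le_levelMass i ω hjB zero_le_one (fun z hz => (hωB z hz).ge) (GpY i (parSymY i) U Ψ)
  rw [one_pow, mul_one] at hMB
  have hMA := sum_filter_hs_le_levelMass i ω hjA hW0.le hW (GpY i (parSymY i) U Ψ)
  have hfin := agmon_arith hc₀0 (inv_pos.2 (by positivity)) hPB0 hQ0 hiX hX2 hMB hMA
  exact agmon_unpack hc₀pos (by positivity) (by positivity) hW0 hQ0 hfin

end Literature.MathematicalPhysics.QuantumFieldTheory.Balaban1983to89.B9Thm31SiteGpDecayReg335Y
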